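import Literature.RepresentationTheory.Kovacevic2021.SU21ModulesFromKTypes
import HarnessLib

/-!
# Arrow reversal in Kovačević's `K`-type data for `SU(2,1)`: a `K`-type adjacent to `V_{n,m}` and
# reachable from it along live arrows is reached by the direct arrow

Continuation of `Literature.RepresentationTheory.Kovacevic2021.SU21ModulesFromKTypes` (the data
`𝒟 : SU21Datum` — a set `S` of `K`-types `(n,m)` and arrow coefficients `A_{n,m}` (to `(n+1,m+3)`),
`B_{n,m}` (to `(n+1,m-3)`), `C_{n,m}` (to `(n-1,m+3)`), `D_{n,m}` (to `(n-1,m-3)`) subject to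
[Kovacevic2021, §3 Thm 2] (b20)–(b45) — and the `𝔤𝔩(3,ℂ)`-module `𝒟.V` they carry).

Source [Kovacevic2021, §3, proof of Thm 2, held text `paper:arxiv-1810.01752` p0006]: "Also,
`a_{nm}, b_{nm}, c_{nm}` and `d_{nm}` are different from `0` if `V_{nm}` and `V_{n±1,m±3}` are `K` types
of an irreducible `(𝔤,K)` module `V`."  The paper gives no proof of this sentence.  This file proves
the combinatorial statement behind it, for an ARBITRARY datum: if the `K`-type `y` adjacent to `x`
(i.e. `y = x + δ` for one of the four arrow directions `δ`) can be reached from `x` by a walk along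
LIVE arrows (non-zero coefficient, source and target in `S`), then the direct arrow `x → y` is live
(`step_of_reach_shift`).  In an irreducible datum every `K`-type is reachable from every other one
(the `K`-types met by a Lie submodule are closed under live arrows), so adjacent `K`-types of an
irreducible datum are linked by live arrows IN BOTH DIRECTIONS (`step_of_forall_reach`); this is the
structural input of the classification of the cohomological data
(`Literature.RepresentationTheory.Kovacevic2021.SU21CohomologicalClassification`).

## The argument (not in the source; elementary)

The relations (b30), (b35), (b40), (b45) say that for each unit square of the `K`-type lattice the two
two-step paths around it carry proportional products of coefficients, with the factors `n ± 1`
in (b40)/(b45) [Kovacevic2021, Thm 2].  Hence (`exists_swap`): if `x → x+σ → x+σ+δ` is a live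
two-step walk with `σ ⊥ δ`, then so is `x → x+δ → x+δ+σ` (the factor `n-1` that could vanish only
does so when the alternative corner has `n = 0`, where no `K`-type lives, and then the relation
forbids the first walk).  Consequently every live walk from `x` to `y` can be SORTED
(`sorted_of_reach`): first `j` steps in direction `δ`, then a live walk using no `δ`-step (a
backtracking pair `δ.rev, δ` is simply dropped).  Along a walk without `δ`-steps the linear form
`φ_δ` (`= ±3(3n+m)` or `±3(3n-m)`) does not decrease, while `φ_δ(x+δ) = φ_δ(x) - 18`; so a sorted walk
from `x` to `x + δ` has `j ≥ 1`, and its first step is the live arrow `x → x+δ`.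

## What is here

* bookkeeping DEFINITIONS with bodies (no named facts): the four directions `Dir` (`A B C D`), their
  action `Dir.shift` / `Dir.shiftN` on `ℤ²`, `Dir.rev`, `Dir.perp`, the potential `Dir.phi`; the
  coefficient `SU21Datum.coef δ`, live steps `SU21Datum.Step δ x y`, `SU21Datum.Adj`,
  `SU21Datum.Reach` (reflexive-transitive closure), `SU21Datum.FreeStep δ` / `FreeReach δ` (live
  steps in a direction `≠ δ`), `SU21Datum.Sorted δ x y`.
* THEOREMS: `exists_swap` (the exchange lemma, 8 cases = (b30), (b35), (b40), (b45) read both ways),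
  `sorted_of_reach`, `phi_le_of_freeReach`, `step_of_reach_shift` (arrow reversal),
  `coef_ne_zero_of_forall_reach` / `step_of_forall_reach` (two-way links under strong connectivity).

## References

* D. Kovačević, *Unitary `(𝔤,K)` modules of `SU(2,1)`*, Acta Math. Spalatensia 1 (2021) 105–125
  (arXiv:1810.01752): §3 Thm 2 (b30)–(b45) and its proof. [Kovacevic2021]
* A. Borel, N. Wallach (2000), VI 4.8–4.11 (the context: `K`-types of the cohomological modules of
  `SU(2,1)`). [BorelWallach2000]
-/

namespace Literature.RepresentationTheory.Kovacevic2021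

/-! ## §1 Directions and steps -/

/-- The four arrow directions of [Kovacevic2021, §3 Thm 1]: `A : (n,m) → (n+1,m+3)`,
`B : (n,m) → (n+1,m-3)`, `C : (n,m) → (n-1,m+3)`, `D : (n,m) → (n-1,m-3)`. [cite: Kovacevic2021, §3 Thm 1] -/
inductive Dir
  | A | B | C | D
  deriving DecidableEq

namespace Dir

/-- the target of the arrow `δ` out of the `K`-type `x = (n,m)` [cite: Kovacevic2021, §3 Thm 1] -/
def shift : Dir → ℤ × ℤ → ℤ × ℤ
  | A, x => (x.1 + 1, x.2 + 3)
  | B, x => (x.1 + 1, x.2 - 3)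
  | C, x => (x.1 - 1, x.2 + 3)
  | D, x => (x.1 - 1, x.2 - 3)

/-- `i` steps in direction `δ` [cite: Kovacevic2021, §3 Thm 1] -/
def shiftN : Dir → ℕ → ℤ × ℤ → ℤ × ℤ
  | A, i, x => (x.1 + i, x.2 + 3 * i)
  | B, i, x => (x.1 + i, x.2 - 3 * i)
  | C, i, x => (x.1 - i, x.2 + 3 * i)
  | D, i, x => (x.1 - i, x.2 - 3 * i)

/-- the opposite direction (`A ↔ D`, `B ↔ C`) [cite: Kovacevic2021, §3 Thm 1] -/
def rev : Dir → Dir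
  | A => D
  | B => C
  | C => B
  | D => A

/-- `σ ⊥ δ`: the two directions are neither equal nor opposite [cite: Kovacevic2021, §3 Thm 2] -/
def perp : Dir → Dir → Bool
  | A, B => true
  | A, C => true
  | B, A => true
  | B, D => true
  | C, A => true
  | C, D => true
  | D, B => true
  | D, C => true
  | _, _ => false

/-- the potential `φ_δ`: drops by `18` along `δ`, rises by `18` along `δ.rev`, is constant along the
two perpendicular directions [folklore] -/
def phi : Dir → ℤ × ℤ → ℤ
  | A, x => -(9 * x.1 + 3 * x.2)
  | B, x => -(9 * x.1 - 3 * x.2)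
  | C, x => 9 * x.1 - 3 * x.2
  | D, x => 9 * x.1 + 3 * x.2

/-- zero steps [cite: Kovacevic2021, §3 Thm 1] -/
@[simp] theorem shiftN_zero (δ : Dir) (x : ℤ × ℤ) : δ.shiftN 0 x = x := by
  cases δ <;> simp [shiftN]

/-- `i+1` steps = one more step after `i` steps [cite: Kovacevic2021, §3 Thm 1] -/
theorem shiftN_succ (δ : Dir) (i : ℕ) (x : ℤ × ℤ) : δ.shiftN (i + 1) x = δ.shift (δ.shiftN i x) := by
  obtain ⟨a, b⟩ := x
  cases δ <;> ext <;> simp only [shiftN, shift] <;> omega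

/-- `i+1` steps = `i` steps after one step [cite: Kovacevic2021, §3 Thm 1] -/
theorem shiftN_succ' (δ : Dir) (i : ℕ) (x : ℤ × ℤ) : δ.shiftN (i + 1) x = δ.shiftN i (δ.shift x) := by
  obtain ⟨a, b⟩ := x
  cases δ <;> ext <;> simp only [shiftN, shift] <;> omega

/-- one step [cite: Kovacevic2021, §3 Thm 1] -/
theorem shiftN_one (δ : Dir) (x : ℤ × ℤ) : δ.shiftN 1 x = δ.shift x := by
  rw [shiftN_succ, shiftN_zero]

/-- the arrow directions commute (the `K`-types form the lattice `ℤ(1,3) ⊕ ℤ(1,-3) + (n₀,m₀)`)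
[cite: Kovacevic2021, §3 Thm 1] -/
theorem shift_comm (δ σ : Dir) (x : ℤ × ℤ) : δ.shift (σ.shift x) = σ.shift (δ.shift x) := by
  obtain ⟨a, b⟩ := x
  cases δ <;> cases σ <;> ext <;> simp only [shift] <;> omega

/-- `i` steps in direction `δ` commute with a step in direction `σ` [cite: Kovacevic2021, §3 Thm 1] -/
theorem shiftN_shift_comm (δ σ : Dir) (i : ℕ) (x : ℤ × ℤ) :
    δ.shiftN i (σ.shift x) = σ.shift (δ.shiftN i x) := by
  obtain ⟨a, b⟩ := x
  cases δ <;> cases σ <;> ext <;> simp only [shift, shiftN] <;> omega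

/-- `δ` after `δ.rev` is the identity [cite: Kovacevic2021, §3 Thm 1] -/
@[simp] theorem shift_rev_shift (δ : Dir) (x : ℤ × ℤ) : δ.shift (δ.rev.shift x) = x := by
  obtain ⟨n, m⟩ := x
  cases δ <;> ext <;> simp only [shift, rev] <;> omega

/-- `δ.rev` after `δ` is the identity [cite: Kovacevic2021, §3 Thm 1] -/
@[simp] theorem rev_shift_shift (δ : Dir) (x : ℤ × ℤ) : δ.rev.shift (δ.shift x) = x := by
  obtain ⟨n, m⟩ := x
  cases δ <;> ext <;> simp only [shift, rev] <;> omega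

/-- `δ.rev ≠ δ` [folklore] -/
private theorem rev_ne_self (δ : Dir) : δ.rev ≠ δ := by cases δ <;> decide

/-- a direction other than `δ` and `δ.rev` is perpendicular to `δ` [folklore] -/
private theorem perp_of_ne {σ δ : Dir} (h₁ : σ ≠ δ) (h₂ : σ ≠ δ.rev) : σ.perp δ = true := by
  cases σ <;> cases δ <;> simp_all [perp, rev]

/-- `φ_δ` drops by `18` along `δ` [folklore] -/
private theorem phi_shift_self (δ : Dir) (x : ℤ × ℤ) : δ.phi (δ.shift x) = δ.phi x - 18 := by
  cases δ <;> simp only [phi, shift] <;> ring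

/-- along a step in a direction `σ ≠ δ` the potential `φ_δ` does not decrease [folklore] -/
private theorem phi_le_phi_shift {σ δ : Dir} (h : σ ≠ δ) (x : ℤ × ℤ) : δ.phi x ≤ δ.phi (σ.shift x) := by
  cases σ <;> cases δ <;> simp only [phi, shift] at h ⊢ <;> first | omega | exact absurd rfl h

end Dir

namespace SU21Datum

variable (𝒟 : SU21Datum)

/-- the coefficient of the arrow `δ` out of `(n,m)` [cite: Kovacevic2021, §3 Thm 1] -/
def coef : Dir → ℤ → ℤ → ℂ
  | .A => 𝒟.A
  | .B => 𝒟.B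
  | .C => 𝒟.C
  | .D => 𝒟.D

/-- **live step**: `x, y ∈ S`, `y = x + δ`, and the arrow coefficient of `δ` at `x` is non-zero.
[cite: Kovacevic2021, §3 Remark 2] -/
structure Step (δ : Dir) (x y : ℤ × ℤ) : Prop where
  /-- the source is a `K`-type -/
  src_mem : x ∈ 𝒟.S
  /-- the target is a `K`-type -/
  tgt_mem : y ∈ 𝒟.S
  /-- the target is the `δ`-neighbour -/
  tgt_eq : y = δ.shift x
  /-- the arrow is live -/
  coef_ne : 𝒟.coef δ x.1 x.2 ≠ 0

/-- a live step in some direction [cite: Kovacevic2021, §3 Remark 2] -/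
def Adj (x y : ℤ × ℤ) : Prop := ∃ δ : Dir, 𝒟.Step δ x y

/-- reachability along live arrows (reflexive-transitive closure of `Adj`) [cite: Kovacevic2021, §3 Remark 2] -/
def Reach : ℤ × ℤ → ℤ × ℤ → Prop := Relation.ReflTransGen 𝒟.Adj

/-- a live step in a direction other than `δ` (walks avoiding `δ` are the tails of sorted walks)
[cite: Kovacevic2021, §3 proof of Thm 2] -/
def FreeStep (δ : Dir) (x y : ℤ × ℤ) : Prop := ∃ σ : Dir, σ ≠ δ ∧ 𝒟.Step σ x y

/-- reachability along live arrows avoiding the direction `δ` [cite: Kovacevic2021, §3 proof of Thm 2] -/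
def FreeReach (δ : Dir) : ℤ × ℤ → ℤ × ℤ → Prop := Relation.ReflTransGen (𝒟.FreeStep δ)

/-- a **sorted walk** from `x` to `y` with respect to `δ`: `j` live `δ`-steps out of `x`, then a live
walk avoiding `δ` ("walk from one vertex to another", sorted by the exchange relations).
[cite: Kovacevic2021, §3 proof of Thm 2 and proof of Thm 3] -/
def Sorted (δ : Dir) (x y : ℤ × ℤ) : Prop :=
  ∃ j : ℕ, (∀ i < j, 𝒟.Step δ (δ.shiftN i x) (δ.shiftN (i + 1) x)) ∧ 𝒟.FreeReach δ (δ.shiftN j x) y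

variable {𝒟}

/-- no arrows out of non-`K`-types [cite: Kovacevic2021, §3 Thm 1] -/
theorem coef_eq_zero (δ : Dir) {n m : ℤ} (h : (n, m) ∉ 𝒟.S) : 𝒟.coef δ n m = 0 := by
  cases δ
  exacts [𝒟.A_eq_zero h, 𝒟.B_eq_zero h, 𝒟.C_eq_zero h, 𝒟.D_eq_zero h]

/-- a non-zero arrow coefficient starts at a `K`-type [cite: Kovacevic2021, §3 Thm 1] -/
theorem mem_of_coef_ne_zero (δ : Dir) {n m : ℤ} (h : 𝒟.coef δ n m ≠ 0) : (n, m) ∈ 𝒟.S :=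
  by_contra fun hS => h (coef_eq_zero δ hS)

/-! ## §2 The exchange lemma: (b30), (b35), (b40), (b45) read both ways -/

/-- **Exchange of two perpendicular live arrows (product form)**: if `x → x+σ` is live and the
`δ`-arrow out of `x+σ` is non-zero (`σ ⊥ δ`), then the `δ`-arrow out of `x` and the `σ`-arrow out of
`x+δ` are both non-zero.  Cases `(σ,δ) = (B,A),(A,B)`: (b30); `(D,C),(C,D)`: (b35); `(A,C),(C,A)`:
(b40); `(B,D),(D,B)`: (b45) — the factor `n+1` never vanishes (`n ≥ 1` on `S`), the factor `n-1` does
not vanish when the walk passes through `x+C` or `x+D` (then `n ≥ 2`).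
[cite: Kovacevic2021, §3 Thm 2 (b30), (b35), (b40), (b45)] -/
theorem coef_mul_coef_ne_zero_of_perp {σ δ : Dir} (hp : σ.perp δ = true) {x : ℤ × ℤ} (hx : x ∈ 𝒟.S)
    (hy : σ.shift x ∈ 𝒟.S) (h1 : 𝒟.coef σ x.1 x.2 ≠ 0) (h2 : 𝒟.coef δ (σ.shift x).1 (σ.shift x).2 ≠ 0) :
    𝒟.coef δ x.1 x.2 * 𝒟.coef σ (δ.shift x).1 (δ.shift x).2 ≠ 0 := by
  obtain ⟨n, m⟩ := x
  have hn : (1 : ℤ) ≤ n := 𝒟.one_le_of_mem hx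
  have hn1 : (n : ℂ) + 1 ≠ 0 := by exact_mod_cast (show n + 1 ≠ 0 by omega)
  have hy' := 𝒟.one_le_of_mem hy
  cases σ <;> cases δ <;> simp only [Dir.perp, Bool.false_eq_true] at hp <;>
    simp only [coef, Dir.shift] at h1 h2 hy' ⊢
  · -- σ = A, δ = B: (b30) `B·A' = A·B'`, the walk is the right-hand side
    rw [𝒟.rel30 n m]; exact mul_ne_zero h1 h2
  · -- σ = A, δ = C: (b40), the walk is the left-hand side
    have h := 𝒟.rel40 n m
    have hL : ((n : ℂ) + 1) * (𝒟.A n m * 𝒟.C (n + 1) (m + 3)) ≠ 0 := mul_ne_zero hn1 (mul_ne_zero h1 h2)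
    rw [h] at hL
    exact right_ne_zero_of_mul hL
  · -- σ = B, δ = A: (b30), the walk is the left-hand side
    rw [← 𝒟.rel30 n m]; exact mul_ne_zero h1 h2
  · -- σ = B, δ = D: (b45), the walk is the left-hand side
    have h := 𝒟.rel45 n m
    have hL : ((n : ℂ) + 1) * (𝒟.B n m * 𝒟.D (n + 1) (m - 3)) ≠ 0 := mul_ne_zero hn1 (mul_ne_zero h1 h2)
    rw [h] at hL
    exact right_ne_zero_of_mul hL
  · -- σ = C, δ = A: (b40), the walk is the right-hand side; `n ≥ 2` since `x + C ∈ S`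
    have h := 𝒟.rel40 n m
    have hn2 : (n : ℂ) - 1 ≠ 0 := by exact_mod_cast (show n - 1 ≠ 0 by omega)
    have hR : ((n : ℂ) - 1) * (𝒟.C n m * 𝒟.A (n - 1) (m + 3)) ≠ 0 := mul_ne_zero hn2 (mul_ne_zero h1 h2)
    rw [← h] at hR
    exact right_ne_zero_of_mul hR
  · -- σ = C, δ = D: (b35) `D·C' = C·D'`, the walk is the right-hand side
    rw [𝒟.rel35 n m]; exact mul_ne_zero h1 h2
  · -- σ = D, δ = B: (b45), the walk is the right-hand side; `n ≥ 2` since `x + D ∈ S`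
    have h := 𝒟.rel45 n m
    have hn2 : (n : ℂ) - 1 ≠ 0 := by exact_mod_cast (show n - 1 ≠ 0 by omega)
    have hR : ((n : ℂ) - 1) * (𝒟.D n m * 𝒟.B (n - 1) (m - 3)) ≠ 0 := mul_ne_zero hn2 (mul_ne_zero h1 h2)
    rw [← h] at hR
    exact right_ne_zero_of_mul hR
  · -- σ = D, δ = C: (b35), the walk is the left-hand side
    rw [← 𝒟.rel35 n m]; exact mul_ne_zero h1 h2

/-- **Exchange lemma (walk form)**: a live walk `x → x+σ → x+σ+δ` with `σ ⊥ δ` can be replaced by the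
live walk `x → x+δ → x+δ+σ` (in particular `x+δ ∈ S`). [cite: Kovacevic2021, §3 Thm 2 (b30)–(b45)] -/
theorem exists_swap {σ δ : Dir} (hp : σ.perp δ = true) {x y z : ℤ × ℤ} (h1 : 𝒟.Step σ x y)
    (h2 : 𝒟.Step δ y z) : 𝒟.Step δ x (δ.shift x) ∧ 𝒟.Step σ (δ.shift x) z := by
  obtain ⟨hx, hy, rfl, hc1⟩ := h1
  obtain ⟨-, hz, rfl, hc2⟩ := h2
  have key := coef_mul_coef_ne_zero_of_perp hp hx hy hc1 hc2
  have hS : δ.shift x ∈ 𝒟.S := mem_of_coef_ne_zero σ (right_ne_zero_of_mul key)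
  exact ⟨⟨hx, hS, rfl, left_ne_zero_of_mul key⟩, ⟨hS, hz, Dir.shift_comm δ σ x, right_ne_zero_of_mul key⟩⟩

/-! ## §3 Sorting live walks -/

/-- cascade of exchanges: a `σ`-step followed by `j` steps in the perpendicular direction `δ` can be
replaced by `j` `δ`-steps followed by the `σ`-step [cite: Kovacevic2021, §3 Thm 2 (b30)–(b45)] -/
theorem cascade {σ δ : Dir} (hp : σ.perp δ = true) (j : ℕ) :
    ∀ x : ℤ × ℤ, 𝒟.Step σ x (σ.shift x) →
      (∀ i < j, 𝒟.Step δ (δ.shiftN i (σ.shift x)) (δ.shiftN (i + 1) (σ.shift x))) →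
      (∀ i < j, 𝒟.Step δ (δ.shiftN i x) (δ.shiftN (i + 1) x)) ∧
        𝒟.Step σ (δ.shiftN j x) (σ.shift (δ.shiftN j x)) := by
  induction j with
  | zero => intro x h _; simpa using h
  | succ j ih =>
    intro x h hsteps
    have h0 := hsteps 0 (Nat.zero_lt_succ j)
    rw [Dir.shiftN_zero, Dir.shiftN_one] at h0
    obtain ⟨hδ, hσ⟩ := exists_swap hp h h0
    rw [Dir.shift_comm] at hσ
    have hrest : ∀ i < j, 𝒟.Step δ (δ.shiftN i (σ.shift (δ.shift x))) (δ.shiftN (i + 1) (σ.shift (δ.shift x))) := by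
      intro i hi
      have := hsteps (i + 1) (by omega)
      rwa [Dir.shiftN_succ' δ i, Dir.shiftN_succ' δ (i + 1), ← Dir.shift_comm σ δ x] at this
    obtain ⟨hδs, hlast⟩ := ih (δ.shift x) hσ hrest
    refine ⟨fun i hi => ?_, by rwa [Dir.shiftN_succ']⟩
    rcases Nat.eq_zero_or_pos i with rfl | hi0
    · rwa [Dir.shiftN_zero, Dir.shiftN_one]
    · obtain ⟨i, rfl⟩ : ∃ i', i = i' + 1 := ⟨i - 1, by omega⟩
      rw [Dir.shiftN_succ' δ i, Dir.shiftN_succ' δ (i + 1)]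
      exact hδs i (by omega)

/-- **Sorting**: every live walk from `x` to `y` can be replaced by `j` live `δ`-steps out of `x`
followed by a live walk avoiding `δ` (exchange perpendicular steps, drop backtracking pairs).
[cite: Kovacevic2021, §3 Thm 2 (b30)–(b45)] -/
theorem sorted_of_reach (δ : Dir) {x y : ℤ × ℤ} (h : 𝒟.Reach x y) : 𝒟.Sorted δ x y := by
  induction h using Relation.ReflTransGen.head_induction_on with
  | refl => exact ⟨0, fun i hi => absurd hi (Nat.not_lt_zero i), by rw [Dir.shiftN_zero]; exact .refl⟩
  | @head x v hxv _ ih =>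
    obtain ⟨σ, hstep⟩ := hxv
    obtain ⟨j, hsteps, hfree⟩ := ih
    have hv : v = σ.shift x := hstep.tgt_eq
    subst hv
    by_cases hσδ : σ = δ
    · -- a `δ`-step: prepend it
      subst hσδ
      refine ⟨j + 1, fun i hi => ?_, by rwa [Dir.shiftN_succ']⟩
      rcases Nat.eq_zero_or_pos i with rfl | hi0
      · rwa [Dir.shiftN_zero, Dir.shiftN_one]
      · obtain ⟨i, rfl⟩ : ∃ i', i = i' + 1 := ⟨i - 1, by omega⟩
        rw [Dir.shiftN_succ' σ i, Dir.shiftN_succ' σ (i + 1)]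
        exact hsteps i (by omega)
    by_cases hrev : σ = δ.rev
    · -- a `δ.rev`-step: either the sorted tail starts with a `δ`-step back to `x` (drop both), or it
      -- has no `δ`-step and the `δ.rev`-step joins the free walk
      subst hrev
      rcases Nat.eq_zero_or_pos j with rfl | hj
      · refine ⟨0, fun i hi => absurd hi (Nat.not_lt_zero i), ?_⟩
        rw [Dir.shiftN_zero] at hfree ⊢
        exact Relation.ReflTransGen.head ⟨δ.rev, Dir.rev_ne_self δ, hstep⟩ hfree
      · obtain ⟨j, rfl⟩ : ∃ j', j = j' + 1 := ⟨j - 1, by omega⟩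
        refine ⟨j, fun i hi => ?_, ?_⟩
        · have := hsteps (i + 1) (by omega)
          rwa [Dir.shiftN_succ' δ i, Dir.shiftN_succ' δ (i + 1), Dir.shift_rev_shift] at this
        · rwa [Dir.shiftN_succ', Dir.shift_rev_shift] at hfree
    · -- a perpendicular step: cascade it through the `δ`-steps
      have hp := Dir.perp_of_ne hσδ hrev
      obtain ⟨hδs, hlast⟩ := cascade hp j x hstep hsteps
      refine ⟨j, hδs, Relation.ReflTransGen.head ⟨σ, hσδ, hlast⟩ ?_⟩
      rwa [← Dir.shiftN_shift_comm]

/-- along a live walk avoiding `δ` the potential `φ_δ` does not decrease [folklore] -/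
private theorem phi_le_of_freeReach (δ : Dir) {x y : ℤ × ℤ} (h : 𝒟.FreeReach δ x y) : δ.phi x ≤ δ.phi y := by
  induction h with
  | refl => exact le_rfl
  | tail _ hst ih =>
    obtain ⟨σ, hσ, hstep⟩ := hst
    rw [hstep.tgt_eq]
    exact ih.trans (Dir.phi_le_phi_shift hσ _)

/-! ## §4 Arrow reversal -/

/-- **Arrow reversal.** If the `δ`-neighbour `x + δ` of `x` is reachable from `x` along live arrows,
then the arrow `x → x + δ` itself is live.  (Sort the walk with respect to `δ`; a walk avoiding `δ`
cannot lower `φ_δ` by `18`, so the sorted walk begins with a `δ`-step out of `x`.)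
[cite: Kovacevic2021, §3 proof of Thm 2 ("`a,b,c,d ≠ 0` if `V_{nm}` and `V_{n±1,m±3}` are `K` types of
an irreducible module")] -/
theorem step_of_reach_shift (δ : Dir) {x : ℤ × ℤ} (h : 𝒟.Reach x (δ.shift x)) : 𝒟.Step δ x (δ.shift x) := by
  obtain ⟨j, hsteps, hfree⟩ := sorted_of_reach δ h
  rcases Nat.eq_zero_or_pos j with rfl | hj
  · rw [Dir.shiftN_zero] at hfree
    have h1 := phi_le_of_freeReach δ hfree
    rw [Dir.phi_shift_self] at h1
    omega
  · have := hsteps 0 hj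
    rwa [Dir.shiftN_zero, Dir.shiftN_one] at this

/-- Arrow reversal, coefficient form: if `(n,m)` and its `δ`-neighbour are `K`-types and the neighbour is
reachable from `(n,m)` along live arrows, the coefficient of `δ` at `(n,m)` is non-zero.
[cite: Kovacevic2021, §3 proof of Thm 2] -/
theorem coef_ne_zero_of_reach (δ : Dir) {x : ℤ × ℤ} (h : 𝒟.Reach x (δ.shift x)) : 𝒟.coef δ x.1 x.2 ≠ 0 :=
  (step_of_reach_shift δ h).coef_ne

/-- **Two-way links under strong connectivity.** If every `K`-type is reachable from every other one
along live arrows (as in an irreducible datum), then for adjacent `K`-types `x`, `x + δ ∈ S` the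
arrow `x → x+δ` is live — and so is the arrow back, by the same statement for `δ.rev` at `x + δ`.
[cite: Kovacevic2021, §3 proof of Thm 2] -/
theorem step_of_forall_reach (hconn : ∀ x ∈ 𝒟.S, ∀ y ∈ 𝒟.S, 𝒟.Reach x y) (δ : Dir) {x : ℤ × ℤ}
    (hx : x ∈ 𝒟.S) (hy : δ.shift x ∈ 𝒟.S) : 𝒟.Step δ x (δ.shift x) :=
  step_of_reach_shift δ (hconn x hx _ hy)

/-- coefficient form of `step_of_forall_reach` [cite: Kovacevic2021, §3 proof of Thm 2] -/
theorem coef_ne_zero_of_forall_reach (hconn : ∀ x ∈ 𝒟.S, ∀ y ∈ 𝒟.S, 𝒟.Reach x y) (δ : Dir)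
    {n m : ℤ} (hx : (n, m) ∈ 𝒟.S) (hy : δ.shift (n, m) ∈ 𝒟.S) : 𝒟.coef δ n m ≠ 0 :=
  (step_of_forall_reach hconn δ hx hy).coef_ne

/-- the back arrow: under strong connectivity, with `x, x+δ ∈ S` also `x+δ → x` is live
[cite: Kovacevic2021, §3 proof of Thm 2] -/
theorem step_rev_of_forall_reach (hconn : ∀ x ∈ 𝒟.S, ∀ y ∈ 𝒟.S, 𝒟.Reach x y) (δ : Dir) {x : ℤ × ℤ}
    (hx : x ∈ 𝒟.S) (hy : δ.shift x ∈ 𝒟.S) : 𝒟.Step δ.rev (δ.shift x) x := by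
  have := step_of_forall_reach hconn δ.rev hy (by rwa [Dir.rev_shift_shift])
  rwa [Dir.rev_shift_shift] at this

/-- **Products.** Under strong connectivity the invariant products `A_{n,m} D_{n+1,m+3}` and
`B_{n,m} C_{n+1,m-3}` [Kovacevic2021, Remark 3] are non-zero exactly when both end points are `K`-types.
[cite: Kovacevic2021, §3 Remark 3, proof of Thm 3] -/
theorem A_mul_D_ne_zero_iff (hconn : ∀ x ∈ 𝒟.S, ∀ y ∈ 𝒟.S, 𝒟.Reach x y) {n m : ℤ} (hx : (n, m) ∈ 𝒟.S) :
    𝒟.A n m * 𝒟.D (n + 1) (m + 3) ≠ 0 ↔ (n + 1, m + 3) ∈ 𝒟.S := by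
  constructor
  · exact fun h => mem_of_coef_ne_zero Dir.D (right_ne_zero_of_mul h)
  · intro hy
    have hA := coef_ne_zero_of_forall_reach hconn Dir.A hx hy
    have hD := (step_rev_of_forall_reach hconn Dir.A hx hy).coef_ne
    exact mul_ne_zero hA hD

/-- the `B C'` product, see `A_mul_D_ne_zero_iff` [cite: Kovacevic2021, §3 Remark 3, proof of Thm 3] -/
theorem B_mul_C_ne_zero_iff (hconn : ∀ x ∈ 𝒟.S, ∀ y ∈ 𝒟.S, 𝒟.Reach x y) {n m : ℤ} (hx : (n, m) ∈ 𝒟.S) :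
    𝒟.B n m * 𝒟.C (n + 1) (m - 3) ≠ 0 ↔ (n + 1, m - 3) ∈ 𝒟.S := by
  constructor
  · exact fun h => mem_of_coef_ne_zero Dir.C (right_ne_zero_of_mul h)
  · intro hy
    have hB := coef_ne_zero_of_forall_reach hconn Dir.B hx hy
    have hC := (step_rev_of_forall_reach hconn Dir.B hx hy).coef_ne
    exact mul_ne_zero hB hC

/-- the `D A''` product (downward) [cite: Kovacevic2021, §3 Remark 3, proof of Thm 3] -/
theorem D_mul_A_ne_zero_iff (hconn : ∀ x ∈ 𝒟.S, ∀ y ∈ 𝒟.S, 𝒟.Reach x y) {n m : ℤ} (hx : (n, m) ∈ 𝒟.S) :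
    𝒟.D n m * 𝒟.A (n - 1) (m - 3) ≠ 0 ↔ (n - 1, m - 3) ∈ 𝒟.S := by
  constructor
  · exact fun h => mem_of_coef_ne_zero Dir.A (right_ne_zero_of_mul h)
  · intro hy
    have hD := coef_ne_zero_of_forall_reach hconn Dir.D hx hy
    have hA := (step_rev_of_forall_reach hconn Dir.D hx hy).coef_ne
    exact mul_ne_zero hD hA

/-- the `C B''` product (downward) [cite: Kovacevic2021, §3 Remark 3, proof of Thm 3] -/
theorem C_mul_B_ne_zero_iff (hconn : ∀ x ∈ 𝒟.S, ∀ y ∈ 𝒟.S, 𝒟.Reach x y) {n m : ℤ} (hx : (n, m) ∈ 𝒟.S) :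
    𝒟.C n m * 𝒟.B (n - 1) (m + 3) ≠ 0 ↔ (n - 1, m + 3) ∈ 𝒟.S := by
  constructor
  · exact fun h => mem_of_coef_ne_zero Dir.B (right_ne_zero_of_mul h)
  · intro hy
    have hC := coef_ne_zero_of_forall_reach hconn Dir.C hx hy
    have hB := (step_rev_of_forall_reach hconn Dir.C hx hy).coef_ne
    exact mul_ne_zero hC hB

end SU21Datum

end Literature.RepresentationTheory.Kovacevic2021
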